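import Summits.BirchSwinnertonDyer.BirchSwinnertonDyer.Theorems.KimAtThreeDeepUpperAdditiveDefectOfFineKato
import Summits.BirchSwinnertonDyer.BirchSwinnertonDyer.Theorems.KimAtThreeDeepUpperCertSupplyDefect
import HarnessLib

/-!
# Route `KimAtThreeKolyvagin` (rung W2), crux `DeepUpperAtThreeOffKatoStratum` (item 19562): the registered
# stub `stub_additiveDefect` VERBATIM from S24-DEEP ×2 + GZK + Poitou–Tate + the FINE KATO PACKAGE WITH
# EXPONENTS (C1ₜₑ) ALONE — the certificate supply (C2) is a THEOREM on every additive tower row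

Cell `bsd-addord`, seat `bsd-addord-w2-acc1` gen 2 (PROGRAMME PART 1b, ACCEL-LIST l.753 row (1)), `--supports`
stmt-BirchSwinnertonDyer-19562 (owner w2-c5 assembles via the registered
`Cruxes.DeepUpperAtThreeOffKatoStratum.Birth.DeepUpperAtThreeOffKatoStratum_of`).  Theorems only (no definition,
no named fact, no instance, no `sorry`); nothing is asserted about any curve; the crux stays OPEN; BSD is not
proved.

## What

The companion `KimAtThreeDeepUpperAdditiveDefectOfFineKato` derives gen 1's displayed port family
`HPortDefectDeep` — hence the stub VERBATIM and the crux BY NAME — from TWO inputs of crux 19560's shape on the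
additive-defect rows: (C1ₜₑ) the fine Kato package with exponents and (C2) the certificate supply.  Seat w2-c3
(gen 4/5) made (C2) a THEOREM on EVERY additive row with `ρ̄_{E,3}` onto: one unit minus modular symbol per row
(`KimAtThreePortSharedC2Supply.unitMinusSymbol_row`: Manin's relation + Chebotarev on `E[3] × (ℤ/|γ|)ˣ`, tree
theorems only) ⟹ Kato's auxiliary cusp datum with unit value certificates (kim3
`KimAtThreeKolyvaginPortSharedCert.certSupply_row_of_unitMinusSymbol`, `9 ∣ N`), packaged for ANY row selector as
`KimAtThreeDeepUpperCertSupplyDefect.certSupply_of_addv` (p474399).  This file feeds it in: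

* `certSupply_allDefectRows` — (C2) in the companion's binder shape (all three defect disjuncts), a theorem.
* OWNER'S TERMS (no wrapper theorems here — the gate's dedup rule identifies a wrapper with the companion's ★,
  whose extra hypothesis it discharges): the REGISTERED STUB VERBATIM is
  `KimAtThreeDeepUpperAdditiveDefectOfFineKato.stub_additiveDefect_of_deepFacts_of_fineKatoTwoExp_of_certSupply
  hS24d hS24d₂ hGZK hPT hC1 certSupply_allDefectRows`, and crux 19562 BY NAME is
  `…OfFineKato.deepUpperAtThreeOffKatoStratum_of_wuthrich_of_fineKatoTwoExp hC1 certSupply_allDefectRows hW hGZK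
  hmod hDD hS24d hS24d₂ hPT`.  READING: the additive-defect rows of 19562 — Kodaira IV/IV* (`3 ∣ c₃`),
  `#E(ℚ₃)[3] ≠ 1`, `3 ∣ c_{D₀}` — carry EXACTLY ONE Kato-side residual object, the fine Kato package (C1ₜₑ)
  (crux 19560's (C1) with n1011's rider clause (ii) ↦ seat acc6's (ii₂) at the row's torsion exponent `t` and
  one defect exponent `e`; in print `t = log₃ #E(ℚ₃)[3]`, `e = v₃(c₃) + v₃(c_P)` — Kim 2026 Rem. 3.8 read at
  `3`), plus the route's S24-DEEP facts, GZK and Poitou–Tate.  No port, no `ht0`, no bad-place certificate, no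
  (C2)/(C3), no (DD)/(U′), no Manin / period / `c₃` hypothesis.
HONEST LIMITS: (C1ₜₑ) is construction-shaped over the tree (Kato's `ZetaBody` family for `P.f` — the conclusion
of the PUBLISHED fact `Kato2004.exists_eulerSystem_expStar_values` up to the `ω`-normalisation of Kato's
constant — WITH finite-level functionals carrying the (Λ)-clauses and the two-exponent rider (ii₂): axioms on
bound witnesses whose model is Kato Thm. 12.5 + Bloch–Kato + r1's LEMMA SAT; never `_holds`); S24-DEEP ×2 are
the route's `S24Deep.*` facts (the price of the depth-`k + 2` data that pay the place `3` without `E(ℚ₃)[3] = 0`);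
nothing is booked.
References: [Kato2004Asterisque] (8.1.3), §9.4, Thm. 9.7, Thm. 6.6 (1), Ex. 13.3; [Kim2022StructureSelmer]
Thm. 3.13, Rem. 3.8, §2.2.2, §3.2.3; [Kim2025RefinedTNC] Thm 1.1, §4.2, §8.1.2; [MazurRubin2004] Thm. 3.2.4,
App. A; [Manin1972] Prop. 1.4, Thm. 1.6; [TateGCFT1967] §2.4; [Sakamoto2024] Thm. 4.4; [Wuthrich2014] Prop. 21;
[MilneADT2006] I.4.10.
-/

set_option autoImplicit false
-- the Theorems namespace of a single-conjunct summit repeats the summit name by design (D-0017)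
set_option linter.dupNamespace false

noncomputable section

open scoped NumberField TensorProduct ContRepresentation Classical
open CategoryTheory Field Function Finset IsDedekindDomain NumberField WeierstrassCurve
open Rat.HeightOneSpectrum
open Literature.NumberTheory.GaloisRepresentations Literature.NumberTheory.GaloisCohomology
open Literature.NumberTheory.GaloisRepresentations.DiscreteGaloisModule
open Literature.NumberTheory.EllipticCurves Literature.NumberTheory.EllipticCurves.ModularForms
open Literature.NumberTheory.EllipticCurves.Rank1Residual
open Literature.NumberTheory.EllipticCurves.Kato2004
open Literature.NumberTheory.EllipticCurves.Kato2004.EulerSystemValues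
open Summit.BirchSwinnertonDyer.Rank1Residual.GaloisImage
open Summit.BirchSwinnertonDyer.BirchSwinnertonDyer.Theses.KimAtThreeKolyvagin
open Summit.BirchSwinnertonDyer.BirchSwinnertonDyer.Theorems.KimAtThreeDeepUpperAdditiveDefectOfFineKato
open Summit.BirchSwinnertonDyer.BirchSwinnertonDyer.Theorems.KimAtThreeDeepUpperAdditiveDefectOfPortEDeep
open Summit.BirchSwinnertonDyer.BirchSwinnertonDyer.Theorems.KimAtThreeDeepUpperOffStratumOfPortFamily
open Summit.BirchSwinnertonDyer.BirchSwinnertonDyer.Theorems.KimAtThreeDeepUpperCertSupplyDefect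

namespace Summit.BirchSwinnertonDyer.BirchSwinnertonDyer.Theorems.KimAtThreeDeepUpperAdditiveDefectOfFineKatoOnly

/-! ### §1 (C2) on the additive-defect rows is a THEOREM (w2-c3 gen 4/5 + kim3 BY NAME) -/

/-- **The certificate supply (C2) on EVERY additive tower row, in the companion's binder shape** (all three
defect disjuncts; the selector, the lattice condition and the Tamagawa / torsion / Manin data are not used):
w2-c3's `KimAtThreeDeepUpperCertSupplyDefect.certSupply_of_addv` (`unitMinusSymbol_row` + kim3's
`certSupply_row_of_unitMinusSymbol`) with surj(3) from the tower at `m = 1`.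
[cite: Manin1972, Prop. 1.4 and Thm. 1.6] [cite: TateGCFT1967, §2.4 (Tchebotarev density theorem)]
[cite: Kato2004Asterisque, Thm. 6.6 (1) (p. 163) and Ex. 13.3 (pp. 224–225)] -/
theorem certSupply_allDefectRows :
    ∀ (W : WeierstrassCurve ℚ) [W.IsElliptic] [W.IsGloballyMinimal],
      (∀ m : ℕ, W.HasSurjectiveModNGaloisRep (3 ^ m : ℕ)) →
      (haveI : Fact (Nat.Prime 3) := ⟨Nat.prime_three⟩; Addv W 3) →
      ∀ {N : ℕ} [NeZero N] (P : ModularParametrizationData W N), N = W.conductorNorm ℤ →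
        (∀ z ∈ P.L.lattice, ∃ w ∈ periodLattice P.f, z = P.c * w) →
        (3 ∣ (W.baseChange ℚ_[3]).localTamagawaNumber ℤ_[3] ∨
          Nat.card {Q : (W.baseChange ℚ_[3]).toAffine.Point // (3 : ℕ) • Q = 0} ≠ 1 ∨
          (3 : ℤ) ∣ P.maninConstant) →
        ∃ (c d a : ℤ) (A : ℕ) (d' : ℤ) (aM : ℕ → ℤ),
          0 < A ∧ Int.gcd c (6 * 3 * A) = 1 ∧ Int.gcd d (6 * 3 * N) = 1 ∧
          (∀ q : ℕ, q.Prime → q ≡ 1 [MOD 3] → ¬ q ∣ 2 * c.natAbs * d.natAbs * A) ∧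
          Int.gcd (c * d) A = 1 ∧ d * d' ≡ 1 [ZMOD (A : ℤ)] ∧ Nat.Coprime A N ∧
          (∀ q ∈ (3 * A).primeFactors, cuspCoeff P.f q = aM q) ∧
          (∏ q ∈ (3 * A).primeFactors,
              (1 - (aM q : ℚ) / q + (if q ∣ N then 0 else (1 / q : ℚ))) ≠ 0) ∧
          padicValRat 3 (∏ q ∈ (3 * A).primeFactors,
              (1 - (aM q : ℚ) / q + (if q ∣ N then 0 else (1 / q : ℚ)))) = 0 ∧
          ((c : ℚ) ^ 2 * (d : ℚ) ^ 2 * ratMinusSymbol P.f ((a : ℚ) / A) -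
              (c : ℚ) * (d : ℚ) ^ 2 * ratMinusSymbol P.f ((a * c : ℚ) / A) -
              (c : ℚ) ^ 2 * (d : ℚ) * ratMinusSymbol P.f ((a * d' : ℚ) / A) +
              (c : ℚ) * (d : ℚ) * ratMinusSymbol P.f ((a * c * d' : ℚ) / A) ≠ 0) ∧
          padicValRat 3 ((c : ℚ) ^ 2 * (d : ℚ) ^ 2 * ratMinusSymbol P.f ((a : ℚ) / A) -
              (c : ℚ) * (d : ℚ) ^ 2 * ratMinusSymbol P.f ((a * c : ℚ) / A) -
              (c : ℚ) ^ 2 * (d : ℚ) * ratMinusSymbol P.f ((a * d' : ℚ) / A) +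
              (c : ℚ) * (d : ℚ) * ratMinusSymbol P.f ((a * c * d' : ℚ) / A)) = 0 := by
  intro W _ _ htow hA N _ P hN _hlat _hdef
  have hs : W.HasSurjectiveModNGaloisRep (3 : ℕ) := by simpa using htow 1
  exact certSupply_of_addv W hs hA P hN

end Summit.BirchSwinnertonDyer.BirchSwinnertonDyer.Theorems.KimAtThreeDeepUpperAdditiveDefectOfFineKatoOnly

end
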